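import Mathlib
import HarnessLib
import Summits.HubbardSuperconductivity.HubbardSuperconductivity.Theorems.KLProgrammeKLRegimeEngineTowerInstProfileLevRate
import Summits.HubbardSuperconductivity.HubbardSuperconductivity.Theorems.KLProgrammeKLRegimeEngineTowerInstUVLevBlockZero

/-!
# Route `KLProgramme` — crux K3 ENGINE (stmt-HubbardSuperconductivity-20437 `KLRegimeEngineV17F2`), stub (b) v2, THE LEVELS PACKAGE (ℓ), instantiation (I3)/(I5):
# THE UV DATUM WITH THE AMPLITUDE DISCOUNT `B⁻²` — the block-`0` profile and the re-measured `R`-rows at a `B`-scaled law parameter `λ ≥ B·ε₀`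
# (cell gate-hubbard-kl, seat hubbard-kl-k3c3-p2 g14, located «(I5)-UV-DISCOUNT»; twins of p4 g18's `klTowerMuLev_blockZero_le` (…InstUVLevBlockZero) and
# `klTowerMuLev_le_profileR_of_levelZero` (…InstProfileLevRate) — E1's (I5) by the substitute precedent; E1 / p4 may rename or supersede)

WHY.  The kit `towerBorn_le_law_tracks_of_profile` needs, besides λ-small rows, the λ-FREE amplitude row `hy`
(`Φ·τ·(ι₁λ + ι₂/(2Q′) + ι₃/(4Q′²) + A′Q′/4) < 1` with `A′Q′³ ≤ ι₃`), hence `Φ·τ·A′·Q′ < 2`.  With the UV floors of `klTowerBLev_le_law_of_inputs[_scaled]`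
(`A′ ≥ W·27⁵·ε_x`, `Q′ ≥ Z·Qe.CE/ε_x²`, from the block-`0` datum at `λ ≥ ε₀ := epsCoupling P U 0`) that is a parameter-free condition on fixed constants.  The design
of the blocked tower (E1-TOWER-BLOCKED §9 (ii)) makes the amplitude FREE DOWNWARD through the constant `B` of `λ = B·ε`: the UV datum `CE^m ε₀^{m−1}` read at
`λ ≥ B·ε₀` is `≤ (27⁵ε_x/B²)·λ^{m−1}·(CE/ε_x²)^m` for every `m ≥ 3` (`B^{1−m} ≤ B^{−2}`, `B ≥ 1`).  This file threads that discount through the UV rows: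

* §1 `pow_div_le_div_sq_mul_pow` — `(λ/B)^{m−1} ≤ λ^{m−1}/B²` (`B ≥ 1`, `m ≥ 3`, `λ ≥ 0`); `uvLaw_div_klLevUnit_zero_le_disc`;
* §2 **`klTowerMuLevAt_blockZero_le_disc`**, **`klTowerMuLev_blockZero_le_disc`** — `klTowerMuLev … d 0 m ≤ (27⁵·ε_x/B²)·λ^{m−1}·(Qe.CE/ε_x²)^m`
  (`m ≥ 3`, `1 ≤ B`, `B·epsCoupling P U 0 ≤ λ`);
* §3 **`klTowerMuLev_le_profileR_of_levelZero_disc`** — the `R`-rows with `A_uv := ε_x/B²`, `Q_uv := Qe.CE/ε_x²`: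
  `A′ = 27⁵(C₁/C₂)8^{d−1}(ε_x/B² + A/(1−((√2)^d)⁻¹))`, `Q′ = C₂²(2^{d−1})⁻¹·max Q (Qe.CE/ε_x²)`.
Compositions of landed theorems and real algebra; nothing about the model is asserted beyond them; nothing asserts (ℓ), any stub, K3 or superconductivity.
References: BGM 2006 §2.8 (2.83), (2.93)–(2.98), Lemma 2.5 [cite: BenfattoGiulianiMastropietro2006].
-/

noncomputable section

namespace Summit.HubbardSuperconductivity.HubbardSuperconductivity.Theorems.EngineV8

set_option linter.dupNamespace false -- summit = problem name (single-conjunct summit), D-0017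

open Classical
open Real Finset Literature.MathematicalPhysics.QuantumLattice Literature.Probability.LatticeModels GrassmannAlgebra
open Literature.MathematicalPhysics.QuantumLattice.FermiRG
open Summit.HubbardSuperconductivity.HubbardSuperconductivity.Theorems.KLProgrammeLegKernels
open Summit.HubbardSuperconductivity.HubbardSuperconductivity.Theorems.KLRegimeSplit

variable {L M : ℕ} [NeZero L] [NeZero M]

/-! ## §1 The discount algebra -/

omit [NeZero L] [NeZero M] in
/-- `(λ/B)^{m−1} ≤ λ^{m−1}/B²` for `B ≥ 1`, `m ≥ 3`, `λ ≥ 0`: the `m − 1 ≥ 2` powers of `B⁻¹ ≤ 1` beyond the second are dropped. [folklore] -/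
theorem pow_div_le_div_sq_mul_pow {lam B : ℝ} (hlam : 0 ≤ lam) (hB : 1 ≤ B) {m : ℕ} (hm : 3 ≤ m) :
    (lam / B) ^ (m - 1) ≤ lam ^ (m - 1) / B ^ 2 := by
  have hB0 : 0 < B := lt_of_lt_of_le one_pos hB
  rw [div_pow]
  exact div_le_div_of_nonneg_left (pow_nonneg hlam _) (pow_pos hB0 2) (pow_le_pow_right₀ hB (by omega))

omit [NeZero L] in
/-- **The UV law in kit units with the discount**: `CE^p ε₀^{p−1}/klLevUnit … t p 0 ≤ (ε_x/B²)·λ^{p−1}·(CE/ε_x²)^p` for `p ≥ 3`, `0 ≤ ε₀`, `B·ε₀ ≤ λ`, `1 ≤ B`.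
[cite: BenfattoGiulianiMastropietro2006, Lemma 2.5 (2.98)] -/
theorem uvLaw_div_klLevUnit_zero_le_disc {β : ℝ} (hβ : 0 < β) {CE ε₀ lam B : ℝ} (hCE : 0 ≤ CE) (hε0 : 0 ≤ ε₀) (hB : 1 ≤ B)
    (hεl : B * ε₀ ≤ lam) (t : Fin 5) {p : ℕ} (hp : 3 ≤ p) :
    CE ^ p * ε₀ ^ (p - 1) / klLevUnit β M t p 0 ≤
      imagTimeWeight β M / B ^ 2 * lam ^ (p - 1) * (CE / imagTimeWeight β M ^ 2) ^ p := by
  have hB0 : 0 < B := lt_of_lt_of_le one_pos hB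
  have hx : 0 < imagTimeWeight β M := by
    unfold imagTimeWeight
    have : (0 : ℝ) < M := Nat.cast_pos.2 (Nat.pos_of_ne_zero (NeZero.ne M))
    positivity
  have hεl' : ε₀ ≤ lam / B := by rw [le_div_iff₀ hB0, mul_comm]; exact hεl
  have hlam : 0 ≤ lam := le_trans (by positivity) hεl
  have h1 := uvLaw_div_klLevUnit_zero_le (M := M) hβ hCE hε0 hεl' t (by omega : 1 ≤ p)
  refine h1.trans ?_
  have h2 : (lam / B) ^ (p - 1) ≤ lam ^ (p - 1) / B ^ 2 := pow_div_le_div_sq_mul_pow hlam hB hp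
  have h0 : 0 ≤ (CE / imagTimeWeight β M ^ 2) ^ p := by positivity
  calc imagTimeWeight β M * (lam / B) ^ (p - 1) * (CE / imagTimeWeight β M ^ 2) ^ p
      ≤ imagTimeWeight β M * (lam ^ (p - 1) / B ^ 2) * (CE / imagTimeWeight β M ^ 2) ^ p :=
        mul_le_mul_of_nonneg_right (mul_le_mul_of_nonneg_left h2 hx.le) h0
    _ = imagTimeWeight β M / B ^ 2 * lam ^ (p - 1) * (CE / imagTimeWeight β M ^ 2) ^ p := by ring

/-! ## §2 Block zero with the discount -/

/-- **The per-track measured array of block `0`, discounted**: `klTowerMuLevAt … d t 0 m ≤ (27⁵·ε_x/B²)·λ^{m−1}·(Qe.CE/ε_x²)^m` for `m ≥ 3`,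
`KernelNormsLevels … K 0`, `0 ≤ Qe.CE`, `1 ≤ B`, `B·epsCoupling P U 0 ≤ λ`, `0 < β`. [cite: BenfattoGiulianiMastropietro2006, Lemma 2.5 (2.98)] -/
theorem klTowerMuLevAt_blockZero_le_disc {P : SplitConsts} {Qe : EngConsts} {β U μ : ℝ} {K : TrigPolyC4v} (hβ : 0 < β) (hP : P.WF)
    (h0 : KernelNormsLevels L M P Qe β U μ K 0) (hCE : 0 ≤ Qe.CE) {lam B : ℝ} (hB : 1 ≤ B) (hεl : B * epsCoupling P U 0 ≤ lam) (d : ℕ)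
    (t : Fin 5) {m : ℕ} (hm : 3 ≤ m) :
    klTowerMuLevAt L M β U μ K d t 0 m ≤ (27 : ℝ) ^ 5 * (imagTimeWeight β M / B ^ 2) * lam ^ (m - 1) * (Qe.CE / imagTimeWeight β M ^ 2) ^ m := by
  have hB0 : 0 < B := lt_of_lt_of_le one_pos hB
  have hK0 : 0 ≤ P.Klam := le_trans zero_le_one hP.1
  have hε0 : 0 ≤ epsCoupling P U 0 := by unfold epsCoupling; positivity
  have hεl' : epsCoupling P U 0 ≤ lam / B := by rw [le_div_iff₀ hB0, mul_comm]; exact hεl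
  have hlam : 0 ≤ lam := le_trans (by positivity) hεl
  have hx : 0 < imagTimeWeight β M := by
    unfold imagTimeWeight
    have : (0 : ℝ) < M := Nat.cast_pos.2 (Nat.pos_of_ne_zero (NeZero.ne M))
    positivity
  have h1 := klTowerMuLevAt_blockZero_le (L := L) (M := M) hβ hP h0 hCE hεl' d t hm
  refine h1.trans ?_
  have h2 : (lam / B) ^ (m - 1) ≤ lam ^ (m - 1) / B ^ 2 := pow_div_le_div_sq_mul_pow hlam hB hm
  have hQ0 : 0 ≤ (Qe.CE / imagTimeWeight β M ^ 2) ^ m := by positivity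
  calc (27 : ℝ) ^ 5 * imagTimeWeight β M * (lam / B) ^ (m - 1) * (Qe.CE / imagTimeWeight β M ^ 2) ^ m
      ≤ (27 : ℝ) ^ 5 * imagTimeWeight β M * (lam ^ (m - 1) / B ^ 2) * (Qe.CE / imagTimeWeight β M ^ 2) ^ m :=
        mul_le_mul_of_nonneg_right (mul_le_mul_of_nonneg_left h2 (by positivity)) hQ0
    _ = (27 : ℝ) ^ 5 * (imagTimeWeight β M / B ^ 2) * lam ^ (m - 1) * (Qe.CE / imagTimeWeight β M ^ 2) ^ m := by ring

/-- **The track-blind measured array of block `0`, discounted**: `klTowerMuLev … d 0 m ≤ (27⁵·ε_x/B²)·λ^{m−1}·(Qe.CE/ε_x²)^m` (`m ≥ 3`, `1 ≤ B`,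
`B·epsCoupling P U 0 ≤ λ`): the kit's `hprof`/`hprof3` at `k = 0` with the UV amplitude `A_uv = 27⁵ε_x/B²`. [cite: BenfattoGiulianiMastropietro2006, Lemma 2.5 (2.98)] -/
theorem klTowerMuLev_blockZero_le_disc {P : SplitConsts} {Qe : EngConsts} {β U μ : ℝ} {K : TrigPolyC4v} (hβ : 0 < β) (hP : P.WF)
    (h0 : KernelNormsLevels L M P Qe β U μ K 0) (hCE : 0 ≤ Qe.CE) {lam B : ℝ} (hB : 1 ≤ B) (hεl : B * epsCoupling P U 0 ≤ lam) (d : ℕ)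
    {m : ℕ} (hm : 3 ≤ m) :
    klTowerMuLev L M β U μ K d 0 m ≤ (27 : ℝ) ^ 5 * (imagTimeWeight β M / B ^ 2) * lam ^ (m - 1) * (Qe.CE / imagTimeWeight β M ^ 2) ^ m := by
  obtain ⟨t, ht⟩ := exists_klTowerMuLev_eq (L := L) (M := M) β U μ K d 0 m
  rw [ht]
  exact klTowerMuLevAt_blockZero_le_disc hβ hP h0 hCE hB hεl d t hm

/-! ## §3 The `R`-rows with the discounted UV datum -/

omit [NeZero L] [NeZero M] in
/-- **THE TRACK-BLIND LEVELLED PROFILE, RATE KEPT, UV DATUM DISCOUNTED** (capped): with `0 ≤ Qe.CE`, `KernelNormsLevels L M P Qe β U μ K 0`, `1 ≤ B`,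
`B·epsCoupling P U 0 ≤ λ` and the law on the blocks `1 ≤ k′ ≤ k` (`3 ≤ p ≤ D`): (a) `m ∈ [4, D]`: `klTowerMuLev … d k m ≤ A′λ^{m−1}Q′^m`; (b) `3 ≤ D`,
`klTowerMuLevAt … d 0 k 3 ≤ X`: `klTowerMuLev … d k 3 ≤ max X (A′λ²Q′³)`; `A′ = 27⁵(C₁/C₂)8^{d−1}(ε_x/B² + A/(1−((√2)^d)⁻¹))`,
`Q′ = C₂²(2^{d−1})⁻¹·max Q (Qe.CE/ε_x²)`, `ε_x = imagTimeWeight β M` — p4's `klTowerMuLev_le_profileR` at `A_uv := ε_x/B²`, `Q_uv := Qe.CE/ε_x²`.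
[cite: BenfattoGiulianiMastropietro2006, §2.8 (2.83), (2.93)-(2.98)] -/
theorem klTowerMuLev_le_profileR_of_levelZero_disc :
    ∃ C₁ C₂ : ℝ, 0 < C₁ ∧ 0 < C₂ ∧ ∀ R : RenConsts, R.WF2 → ∃ c₃' : ℝ, 0 < c₃' ∧ ∃ U₀' : ℝ, 0 < U₀' ∧
      ∀ (P : SplitConsts) (c : ℝ), P.WF → 0 < c → c ≤ klEngC₃6 P R → c ≤ c₃' →
      ∀ μ ∈ klWindowC, ∀ U : ℝ, 0 < U → U ≤ klEngU₀9 P R c → U ≤ U₀' → ∀ β : ℝ, klBetaMin ≤ β → β ≤ Real.exp (c / U ^ 2) →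
      ∀ K : TrigPolyC4v, FrameOK R U (nScales β) μ K → ∀ (L M : ℕ) [NeZero L] [NeZero M],
      klEngL₃ β U ≤ L → klEngM₃ β U L ≤ M → ∀ d k : ℕ, 2 ≤ d → 1 ≤ k → d * k - 1 ≤ nScales β + 1 → ∀ D : ℕ,
      ∀ (Qe : EngConsts), 0 ≤ Qe.CE → KernelNormsLevels L M P Qe β U μ K 0 →
      ∀ (A lam Q B : ℝ), 0 ≤ A → 0 ≤ Q → 1 ≤ B → B * epsCoupling P U 0 ≤ lam →
        (∀ k' : ℕ, 1 ≤ k' → k' ≤ k → ∀ (t : Fin 5) (p : ℕ), 3 ≤ p → p ≤ D → klTowerBLev L M β U μ K d t k' p ≤ A * lam ^ (p - 1) * Q ^ p) →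
      (∀ m : ℕ, 4 ≤ m → m ≤ D →
        klTowerMuLev L M β U μ K d k m ≤
          (27 : ℝ) ^ 5 * (C₁ / C₂) * (8 : ℝ) ^ (d - 1) * (imagTimeWeight β M / B ^ 2 + A / (1 - (Real.sqrt 2 ^ d)⁻¹)) * lam ^ (m - 1) *
            (C₂ ^ 2 * ((2 : ℝ) ^ (d - 1))⁻¹ * max Q (Qe.CE / imagTimeWeight β M ^ 2)) ^ m) ∧
      (∀ X : ℝ, 3 ≤ D → klTowerMuLevAt L M β U μ K d 0 k 3 ≤ X →
        klTowerMuLev L M β U μ K d k 3 ≤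
          max X ((27 : ℝ) ^ 5 * (C₁ / C₂) * (8 : ℝ) ^ (d - 1) * (imagTimeWeight β M / B ^ 2 + A / (1 - (Real.sqrt 2 ^ d)⁻¹)) * lam ^ 2 *
            (C₂ ^ 2 * ((2 : ℝ) ^ (d - 1))⁻¹ * max Q (Qe.CE / imagTimeWeight β M ^ 2)) ^ 3)) := by
  obtain ⟨C₁, C₂, hC₁, hC₂, h⟩ := klTowerMuLev_le_profileR
  refine ⟨C₁, C₂, hC₁, hC₂, fun R hR2 => ?_⟩
  obtain ⟨c₃, hc₃, U₀, hU₀, h'⟩ := h R hR2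
  refine ⟨c₃, hc₃, U₀, hU₀, ?_⟩
  intro P c hP hc hc6 hc₃' μ hμ U hU hU9 hU₀' β hβmin hβc K hK L M _ _ hL3 hM3 d k hd hk1 hkN D Qe hCE h0 A lam Q B hA hQ hB hεl hIH
  have hβ : 0 < β := KLRegimeSplit.pos_of_klBetaMin_le hβmin
  have hB0 : 0 < B := lt_of_lt_of_le one_pos hB
  have hK0 : 0 ≤ P.Klam := le_trans zero_le_one hP.1
  have hε0 : 0 ≤ epsCoupling P U 0 := by unfold epsCoupling; positivity
  have hlam : 0 ≤ lam := le_trans (by positivity) hεl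
  have hx : 0 < imagTimeWeight β M := by
    unfold imagTimeWeight
    have : (0 : ℝ) < M := Nat.cast_pos.2 (Nat.pos_of_ne_zero (NeZero.ne M))
    positivity
  have hQuv : 0 ≤ Qe.CE / imagTimeWeight β M ^ 2 := by positivity
  have hAuv : 0 ≤ imagTimeWeight β M / B ^ 2 := by positivity
  exact h' P c hP hc hc6 hc₃' μ hμ U hU hU9 hU₀' β hβmin hβc K hK L M hL3 hM3 d k hd hk1 hkN D A lam Q (imagTimeWeight β M / B ^ 2)
    (Qe.CE / imagTimeWeight β M ^ 2) hA hlam hQ hAuv hQuv (fun t p => klTowerMeasLev L M β U μ K d 0 (2 * p) ((t : ℕ) + 1))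
    (fun t p => klTowerMeasLev_nonneg hβ.le U μ K d 0 (2 * p) _)
    (fun t p Ωe' hlev => klAnisoLegKernelNormAt_le_klTowerMeasLev_zero β U μ K d t p Ωe' hlev)
    (fun t p hp => (div_le_div_of_nonneg_right (klTowerMeasLev_zero_le_of_kernelNormsLevels h0 hCE hε0 d hp _) (klLevUnit_pos hβ t p 0).le).trans
      (uvLaw_div_klLevUnit_zero_le_disc hβ hCE hε0 hB hεl t hp))
    hIH

end Summit.HubbardSuperconductivity.HubbardSuperconductivity.Theorems.EngineV8

end
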